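import Summits.NavierStokesRegularity.FunctionalMining.StretchingLaminateEigen
import Summits.NavierStokesRegularity.FunctionalMining.StretchingLaminateCapClaim
import Summits.NavierStokesRegularity.FunctionalMining.LaminateCapPolyT4
import Mathlib.Tactic.Linarith
import HarnessLib

/-!
# FunctionalMining — K1-Q1 laminates: `C_lam ≤ 1.077708` in the KERNEL, TWO ROUTES (dict seat; binds census-1 A's claim file as theorems and census-2 B's as an `example`)

search for candidate a priori estimates; no regularity claim.  Three-line bindings; nothing about Navier–Stokes solutions.

THEOREM L-CAP v1 (T4) of bank g5 (`K1Q1-LAMINATE-CAP.md` §2–3) as a kernel theorem for finite div-free lamination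
trees. ROUTE A (theorems): census-1 (A)'s kernel certificate `LaminateCap.lamcap_T4_claim_min` of the polynomial CLAIM
(`StretchingLaminateCapClaim.lean`, Mathlib-only) ∘ the generic pipeline `Laminate.ratioBound_of_polyClaim` (dict
(an)/(ao)/(ap)/(aq), bank's eigenframe blocks): **`Laminate.ratioBound_lcap : RatioBound (269427/250000)`**,
**`Laminate.laminateSupConst_le_lcap : laminateSupConst ≤ 269427/250000`**, **`lcapLeafClaim_holds : LCapLeafClaim`**
(the node of (ap) is a theorem). ROUTE B (an `example`, so that no declaration is duplicated; referee F32.2): census-2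
(B)'s independent kernel certificate `LaminateCapPoly.phiT4_nonpos` (`LaminateCapPolyT4.lean`) yields the SAME
`PolyClaim` statement — the two-party structure of the claim is visible in the kernel. `LaminateDeficit` (the node of
(ae)) is the tree theorem `Laminate.laminateDeficit_nine_eighths` (`StretchingLaminateNineEighths.lean`, census-free,
`C_lam ≤ 9/8`); it is not restated here. The sharper T6 cap `C_lam ≤ 255297/250000 = 1.021188` is the tree theorem
`Laminate.laminateSupConst_le_lcap6` (`StretchingLaminateCapFinal6.lean`). This caps ONE lower-bound METHOD
(lamination trees) for the stretching constant; `C⋆` itself is untouched unless `LaminatesSharp`.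
search for candidate a priori estimates; no regularity claim.
-/


namespace Summit.NavierStokesRegularity.FunctionalMining

namespace Laminate

/-- census-1 (A)'s kernel claim `lamcap_T4_claim_min`, restated as `PolyClaim` at the T4 multipliers. [ours; bookkeeping] -/
theorem lcapPolyClaim : PolyClaim (269427 / 250000) (-562019 / 1000000) (2007 / 15625) (55539 / 40000000) := by
  intro m q s hm0 hm1 _hq _hs _hlo hhi
  have h := LaminateCap.lamcap_T4_claim_min m q s hm0 hm1 hhi
  linarith

/-- ROUTE B (referee F32.2): census-2 (B)'s independent kernel claim `phiT4_nonpos` gives the same `PolyClaim` (an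
`example`: the statement is `lcapPolyClaim`'s, so nothing is re-declared). [ours; bookkeeping] -/
example : PolyClaim (269427 / 250000) (-562019 / 1000000) (2007 / 15625) (55539 / 40000000) := by
  intro m q s hm0 hm1 _hq hs hlo hhi
  have h := LaminateCapPoly.phiT4_nonpos m q s hm0 hm1 hs hlo hhi
  unfold LaminateCapPoly.phiT4 at h
  linarith

/-- **`RatioBound (269427/250000)`** — THEOREM L-CAP v1 (T4) in the kernel. [ours; elementary] -/
theorem ratioBound_lcap : RatioBound (269427 / 250000) :=
  ratioBound_of_polyClaim (by norm_num) (by norm_num) lcapPolyClaim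

/-- **`C_lam ≤ 269427/250000 = 1.077708`**. [ours; elementary] -/
theorem laminateSupConst_le_lcap : laminateSupConst ≤ 269427 / 250000 :=
  laminateSupConst_le_of_ratioBound ratioBound_lcap

end Laminate

/-- The node `LCapLeafClaim` of (ap) holds. [ours; elementary] -/
theorem lcapLeafClaim_holds : LCapLeafClaim :=
  Laminate.lcapLeafClaim_of_polyClaim Laminate.lcapPolyClaim

/-- `LaminateDeficit` re-derived from the T4 cap (an `example`; the tree theorem is
`Laminate.laminateDeficit_nine_eighths`). [ours; elementary] -/
example : LaminateDeficit :=
  Laminate.laminateDeficit_of_lcapClaim lcapLeafClaim_holds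

end Summit.NavierStokesRegularity.FunctionalMining
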